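import Literature.AlgebraicGeometry.HodgeTheory.FermatSurfaceModelCharts
import Literature.AlgebraicGeometry.HodgeTheory.FermatSurfaceModelFibres
import Literature.Analysis.Complex.RotationEigenfunctionOrder
import HarnessLib

/-!
# Holomorphic models of the Fermat surface: the invariant quotient function of an eigen-ratio is bounded near the special fibres

Family `hodge`, layer `Literature/AlgebraicGeometry/HodgeTheory`. PROOF FILE (theorems only; no
definition, no named fact — D-0026), continuing `FermatSurfaceModelFibres` /
`FermatSurfaceModelCharts`, on the path of the analytic leaf `hmodel` of
`AokiShioda1983_eigenline_le_neronSeveri_holds_of_modelEigenforms`. Data: a holomorphic model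
`(ψ, Φ)` of the Fermat surface with its `μₘ⁴`-action, a character `β` with `⟨β_r⟩ ≥ 1` for
`r ≠ 0` and `a₀^{Σ⟨β_r⟩} = 1` on `μₘ⁴`, a function `f₀` holomorphic on `M₀` transforming by
`f₀(Φ_a x) ∏_r (a_r/a₀) = χ_β(a) f₀(x)` (the ratio `η(e)/ω₀(e)` of a `χ_β`-eigen holomorphic
`2`-form, `fermatRatio_symm`), and its invariant quotient `F = f₀ / ∏_r y_r^{⟨β_r⟩ − 1}`
(`fermatQuotientFn_symm`). Along a LINE `y_jᵐ = A y_iᵐ + B` (`B ≠ 0, −1`) of the `u`-plane the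
function `F` stays bounded near the "special fibre" `{y_i = 0}`:

* `sum_univ_eq_of_cover`, `prod_univ_eq_of_cover` — bookkeeping over the four indices
  `{0, i, j, l}`;
* `exists_bound_near_specialFibre` — **there are `δ > 0` and `C` with `‖F x‖ ≤ C` for all
  `x ∈ M₀` with no vanishing coordinate, `‖y_i x‖ < δ` and `y_j(x)ᵐ = A y_i(x)ᵐ + B`.**

Proof (Shioda's character computation (1.7) read analytically): at a point `p` with `y_i(p) = 0`,
`y_j(p)ᵐ = B`, `y_l(p)ᵐ = −1 − B`, the coordinates `(y_i, y_j)` are a holomorphic chart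
(`exists_coordChart`); the curve `Γ(s)` with `y_i = s`, `y_j = c(s)`, `c(s)ᵐ = A sᵐ + B`
(`exists_analyticAt_pow_eq`, `exists_liftedCurve`) is carried to itself by the rotation
`a = (1, …, ζ, …, 1)` (`ζ` a primitive `m`-th root of unity in slot `i`): `Φ_a(Γ s) = Γ(ζ s)`,
both points lying in the chart source with the same coordinates. Hence `φ = f₀ ∘ Γ` satisfies
`φ(ζ s) = ζ^{⟨β_i⟩ − 1} φ(s)` and vanishes to that order (`isBigO_pow_of_rotation_eigen`), so
`F(Γ s) = φ(s) / (s^{⟨β_i⟩−1} ∏_{r ≠ i} y_r(Γ s)^{⟨β_r⟩−1})` is bounded for small `s ≠ 0`; every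
`x` as in the statement lies in the fibre of `Γ(y_i x)`, where `F` takes the same value
(`fermatQuotientFn_eq_of_pow_eq`).

## References

* [Shioda1979HodgeFermat] T. Shioda, The Hodge conjecture for Fermat varieties, Math. Ann. 245
  (1979) 175–184, §1 (1.7).
* [Forster1981] O. Forster, Lectures on Riemann Surfaces, GTM 81 (1981), §8.
-/

noncomputable section

open scoped Manifold ContDiff Topology LinearAlgebra.Projectivization
open Set Filter Projectivization Function

namespace Literature.AlgebraicGeometry.HodgeTheory

open Literature.AlgebraicGeometry.Motives Literature.NumberTheory.Transcendental
  Literature.Geometry.Kaehler Literature.Analysis.Complex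

/-! ### Bookkeeping over the four indices -/

section Indices

variable {i j l : Fin (2 + 2)} (hcover : ∀ r, r = i ∨ r = j ∨ r = 0 ∨ r = l)
  (hi : i ≠ 0) (hj : j ≠ 0) (hl : l ≠ 0) (hij : i ≠ j) (hil : i ≠ l) (hjl : j ≠ l)

include hcover in
/-- `Fin 4 = {0, i, j, l}` as finite sets. [folklore] -/
theorem univ_eq_of_cover : (Finset.univ : Finset (Fin (2 + 2))) = {0, i, j, l} := by
  ext r
  simp only [Finset.mem_univ, Finset.mem_insert, Finset.mem_singleton, true_iff]
  rcases hcover r with h | h | h | h <;> simp [h]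

include hcover hi hj hl hij hil hjl in
/-- `Σ_r g r = g 0 + g i + g j + g l`. [folklore] -/
theorem sum_univ_eq_of_cover {α : Type*} [AddCommMonoid α] (g : Fin (2 + 2) → α) :
    ∑ r, g r = g 0 + g i + g j + g l := by
  rw [univ_eq_of_cover hcover, Finset.sum_insert (by simp [hi.symm, hj.symm, hl.symm]),
    Finset.sum_insert (by simp [hij, hil]), Finset.sum_insert (by simp [hjl]), Finset.sum_singleton]
  simp only [add_assoc]

include hcover hi hj hl hij hil hjl in
/-- `∏_r g r = g 0 · g i · g j · g l`. [folklore] -/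
theorem prod_univ_eq_of_cover {α : Type*} [CommMonoid α] (g : Fin (2 + 2) → α) :
    ∏ r, g r = g 0 * g i * g j * g l := by
  rw [univ_eq_of_cover hcover, Finset.prod_insert (by simp [hi.symm, hj.symm, hl.symm]),
    Finset.prod_insert (by simp [hij, hil]), Finset.prod_insert (by simp [hjl]), Finset.prod_singleton]
  simp only [mul_assoc]

end Indices

section Surface

variable {m : ℕ} {E : Type*} [NormedAddCommGroup E] [NormedSpace ℂ E] [FiniteDimensional ℂ E]
  {M : Type*} [TopologicalSpace M] [ChartedSpace E M] [IsManifold 𝓘(ℂ, E) ω M]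
  {ψ : M → ℙ ℂ (Fin (2 + 2) → ℂ)} {Φ : fermatGroup 2 m → M → M}

/-- The rotation `a = (1, …, ζ, …, 1)` (`ζ` in slot `i ≠ 0`): its coordinates, the product
`∏_r a_r/a₀ = ζ` and the character value `χ_β(a) = ζ^{⟨β_i⟩}`. [cite: Shioda1979HodgeFermat, §1 (1.7)] -/
theorem fermatGroupSingle_data {i : Fin (2 + 2)} (hi : i ≠ 0) (ζ : rootsOfUnity m ℂ)
    (β : Fin (2 + 2) → ZMod m) :
    (∀ r, ((fermatGroupSingle i ζ : fermatGroup 2 m) : Fin (2 + 2) → ℂˣ) r =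
        if r = i then (ζ : ℂˣ) else 1) ∧
      (∏ r, ((((fermatGroupSingle i ζ : fermatGroup 2 m) : Fin (2 + 2) → ℂˣ) r : ℂˣ) : ℂ) /
          ((((fermatGroupSingle i ζ : fermatGroup 2 m) : Fin (2 + 2) → ℂˣ) 0 : ℂˣ) : ℂ)) =
        ((ζ : ℂˣ) : ℂ) ∧
      ((fermatCharacter m β (fermatGroupSingle i ζ) : ℂˣ) : ℂ) = ((ζ : ℂˣ) : ℂ) ^ (β i).val := by
  have hcoord : ∀ r, ((fermatGroupSingle i ζ : fermatGroup 2 m) : Fin (2 + 2) → ℂˣ) r =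
      if r = i then (ζ : ℂˣ) else 1 := by
    intro r
    simp only [fermatGroupSingle, fermatGroupEquiv_apply_coe]
    by_cases hr : r = i
    · subst hr; simp
    · simp [hr]
  refine ⟨hcoord, ?_, ?_⟩
  · have h0 : ((fermatGroupSingle i ζ : fermatGroup 2 m) : Fin (2 + 2) → ℂˣ) 0 = 1 := by
      rw [hcoord 0, if_neg (Ne.symm hi)]
    simp_rw [h0, Units.val_one, div_one]
    rw [Finset.prod_eq_single i (fun r _ hr ↦ by rw [hcoord r, if_neg hr, Units.val_one])
      (by simp), hcoord i, if_pos rfl]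
  · rw [fermatCharacter_fermatGroupSingle, Units.val_pow_eq_pow_val]

variable (hΦψ : ∀ (a : fermatGroup 2 m) (x : M), ψ (Φ a x) =
    Projectivization.mk ℂ ((a : Fin (2 + 2) → ℂˣ) • (ψ x).rep)
      ((smul_ne_zero_iff_ne (a : Fin (2 + 2) → ℂˣ)).mpr (Projectivization.rep_nonzero _)))

include hΦψ in
/-- **`F` is bounded near the special fibre `{y_i = 0}` along the line `y_jᵐ = A y_iᵐ + B`.**
Hypotheses: the model `(ψ, Φ)` of the Fermat surface (`m ≥ 1`, `dim_ℂ E = 2`, `ψ` an embedding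
onto `V(Σ xᵢᵐ)` with holomorphic coordinates, `Φ_a` holomorphic over `[x] ↦ [a • x]`); distinct
indices `i, j, l ≠ 0`; `⟨β_r⟩ ≥ 1` for `r ≠ 0` and `a₀^{Σ⟨β_r⟩} = 1` on `μₘ⁴`; `f₀` complex
differentiable on `M₀` with `f₀(Φ_a x) ∏ (a_r/a₀) = χ_β(a) f₀(x)`; `F = f₀ / ∏_r y_r^{⟨β_r⟩ − 1}`;
constants `A` and `B ≠ 0, −1`. Conclusion: some `δ > 0`, `C` bound `‖F x‖ ≤ C` for all `x ∈ M₀`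
with all `y_r(x) ≠ 0`, `‖y_i(x)‖ < δ` and `y_j(x)ᵐ = A y_i(x)ᵐ + B`.
[cite: Shioda1979HodgeFermat, §1 (1.7)] [cite: Forster1981, §8 Thm. 8.4] -/
theorem exists_bound_near_specialFibre [NeZero m] (hψ : Topology.IsEmbedding ψ)
    (hrange : Set.range ψ = projZeroLocus {fermatPolynomial ℂ 2 m}) (hhol : HasHolomorphicCoords E ψ)
    (h2 : Module.finrank ℂ E = 2) (hΦd : ∀ a, MDifferentiable 𝓘(ℂ, E) 𝓘(ℂ, E) (Φ a))
    {i j l : Fin (2 + 2)} (hcover : ∀ r, r = i ∨ r = j ∨ r = 0 ∨ r = l)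
    (hi : i ≠ 0) (hj : j ≠ 0) (hl : l ≠ 0) (hij : i ≠ j) (hil : i ≠ l) (hjl : j ≠ l)
    {β : Fin (2 + 2) → ZMod m} (hb : ∀ r, r ≠ 0 → 1 ≤ (β r).val)
    (hsum : ∀ a : fermatGroup 2 m, (((a : Fin (2 + 2) → ℂˣ) 0 : ℂˣ) : ℂ) ^ (∑ r, (β r).val) = 1)
    {f₀ : M → ℂ} (hf₀d : ∀ x ∈ liftDomain ψ 0, MDifferentiableAt 𝓘(ℂ, E) 𝓘(ℂ, ℂ) f₀ x)
    (hf₀ : ∀ (a : fermatGroup 2 m) (x : M), x ∈ liftDomain ψ 0 →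
      f₀ (Φ a x) * ∏ r, ((((a : Fin (2 + 2) → ℂˣ) r : ℂˣ) : ℂ) / (((a : Fin (2 + 2) → ℂˣ) 0 : ℂˣ) : ℂ)) =
        ((fermatCharacter m β a : ℂˣ) : ℂ) * f₀ x)
    {Fq : M → ℂ} (hFq : ∀ x, Fq x = f₀ x / ∏ r, projLift ψ 0 x r ^ ((β r).val - 1))
    (A : ℂ) {B : ℂ} (hB : B ≠ 0) (hB1 : 1 + B ≠ 0) :
    ∃ δ > 0, ∃ C : ℝ, ∀ x ∈ liftDomain ψ 0, (∀ r, projLift ψ 0 x r ≠ 0) →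
      ‖projLift ψ 0 x i‖ < δ → projLift ψ 0 x j ^ m = A * projLift ψ 0 x i ^ m + B → ‖Fq x‖ ≤ C := by
  have hm : m ≠ 0 := NeZero.ne m
  have hmpos : 0 < m := Nat.pos_of_ne_zero hm
  have hψc := hψ.continuous
  have hinj := hψ.injective
  have hsum4 := fun {α : Type _} [AddCommMonoid α] (g : Fin (2 + 2) → α) ↦
    sum_univ_eq_of_cover hcover hi hj hl hij hil hjl g
  have hprod4 := fun {α : Type _} [CommMonoid α] (g : Fin (2 + 2) → α) ↦
    prod_univ_eq_of_cover hcover hi hj hl hij hil hjl g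
  -- STEP 0: a point `p` of the special fibre
  obtain ⟨c₀, hc₀⟩ := IsAlgClosed.exists_pow_nat_eq B hmpos
  obtain ⟨c₀', hc₀'⟩ := IsAlgClosed.exists_pow_nat_eq (-(1 + B)) hmpos
  have hc₀0 : c₀ ≠ 0 := by rintro rfl; rw [zero_pow hm] at hc₀; exact hB hc₀.symm
  have hc₀'0 : c₀' ≠ 0 := by
    rintro rfl; rw [zero_pow hm] at hc₀'; exact hB1 (neg_eq_zero.mp hc₀'.symm)
  set v : Fin (2 + 2) → ℂ := fun r ↦ if r = i then 0 else if r = j then c₀ else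
    if r = l then c₀' else 1 with hv
  have hv0 : v 0 = 1 := by simp [hv, hi.symm, hj.symm, hl.symm]
  have hvi : v i = 0 := by simp [hv]
  have hvj : v j = c₀ := by simp [hv, Ne.symm hij]
  have hvl : v l = c₀' := by simp [hv, Ne.symm hil, Ne.symm hjl]
  have hvsum : ∑ r, v r ^ m = 0 := by
    rw [hsum4, hv0, hvi, hvj, hvl, one_pow, zero_pow hm, hc₀, hc₀']
    ring
  obtain ⟨p, hp, hpv⟩ := exists_projLift_eq hrange hv0 hvsum
  have hpi : projLift ψ 0 p i = 0 := by rw [hpv, hvi]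
  have hpj : projLift ψ 0 p j = c₀ := by rw [hpv, hvj]
  have hpl : projLift ψ 0 p l = c₀' := by rw [hpv, hvl]
  -- STEP 1: the chart `(y_i, y_j)` at `p`
  obtain ⟨e, hpe, hesrc, -, hesymm, he1⟩ :=
    exists_coordChart (k := 0) hψ hrange.le hhol h2 hcover hp (by rw [hpl]; exact hc₀'0)
  -- STEP 2: the holomorphic root `c(s)ᵐ = A sᵐ + B`, `c 0 = c₀`
  obtain ⟨c, hcan, hc0, hcpow, hcinv⟩ := exists_analyticAt_pow_eq hm A hB hc₀
  -- STEP 3: the lifted curve `Γ`: `y_i = s`, `y_j = c s`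
  obtain ⟨Γ, hΓ0, hΓd0, hΓev⟩ := exists_liftedCurve (ψ := ψ) e hpe hesymm he1 (r₁ := fun s ↦ s)
    (r₂ := c) (t₀ := 0) analyticAt_id hcan (by rw [hpi]) (by rw [hc0, hpj])
  -- STEP 4: the rotation `a = (1, …, ζ, …, 1)` in slot `i`
  set ζ : ℂ := Complex.exp (2 * Real.pi * Complex.I / m) with hζdef
  have hζ : IsPrimitiveRoot ζ m := Complex.isPrimitiveRoot_exp m hm
  set ζu : rootsOfUnity m ℂ := hζ.toRootsOfUnity with hζu
  have hζuval : (((ζu : ℂˣ)) : ℂ) = ζ := rfl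
  set a : fermatGroup 2 m := fermatGroupSingle i ζu with ha
  obtain ⟨hacoord, haprod, haχ⟩ := fermatGroupSingle_data (m := m) hi ζu β
  rw [hζuval] at haprod haχ
  have hζm : ζ ^ m = 1 := hζ.pow_eq_one
  have hζ0 : ζ ≠ 0 := hζ.ne_zero hm
  -- `Φ_a` fixes `p`
  have hap : Φ a p = p := by
    refine symm_apply_eq_self_of hΦψ hinj a hp fun r hr ↦ ?_
    have hri : r ≠ i := by rintro rfl; exact hr hpi
    rw [ha, hacoord r, if_neg hri, hacoord 0, if_neg (Ne.symm hi)]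
  -- STEP 5: equivariance of the curve: `Φ_a (Γ s) = Γ (ζ s)` near `0`
  have hΓcont : ContinuousAt Γ 0 := hΓd0.continuousAt
  have hΦΓsrc : ∀ᶠ s in 𝓝 (0 : ℂ), Φ a (Γ s) ∈ e.source := by
    have hc' : ContinuousAt (fun s ↦ Φ a (Γ s)) 0 :=
      ((hΦd a).continuous.continuousAt).comp hΓcont
    have hmem : e.source ∈ 𝓝 (Φ a (Γ 0)) := by
      rw [hΓ0, hap]; exact e.open_source.mem_nhds hpe
    exact hc'.preimage_mem_nhds hmem
  have hmulc : Continuous fun s : ℂ ↦ ζ * s := continuous_const.mul continuous_id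
  have hΓevζ : ∀ᶠ s in 𝓝 (0 : ℂ), Γ (ζ * s) ∈ e.source ∧
      MDifferentiableAt 𝓘(ℂ, ℂ) 𝓘(ℂ, E) Γ (ζ * s) ∧
      projLift ψ 0 (Γ (ζ * s)) i = ζ * s ∧ projLift ψ 0 (Γ (ζ * s)) j = c (ζ * s) := by
    have h0 : (fun s : ℂ ↦ ζ * s) 0 = 0 := by simp
    exact hmulc.continuousAt.tendsto.eventually (h0 ▸ hΓev :)
  have heq : ∀ᶠ s in 𝓝 (0 : ℂ), Φ a (Γ s) = Γ (ζ * s) := by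
    filter_upwards [hΓev, hΓevζ, hΦΓsrc] with s hs hsζ hΦs
    obtain ⟨hsrc, -, hyi, hyj⟩ := hs
    obtain ⟨hsrcζ, -, hyiζ, hyjζ⟩ := hsζ
    have hΓs0 : Γ s ∈ liftDomain ψ 0 := (hesrc hsrc).1
    refine e.injOn hΦs hsrcζ (Prod.ext ?_ (Subsingleton.elim _ _))
    rw [he1 _ hΦs, he1 _ hsrcζ, projLift_zero_symm hΦψ a hΓs0 i, projLift_zero_symm hΦψ a hΓs0 j,
      hyi, hyj, hyiζ, hyjζ, ha, hacoord i, if_pos rfl, hacoord j, if_neg (Ne.symm hij), hacoord 0,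
      if_neg (Ne.symm hi), hζuval, hcinv ζ s hζm]
    simp
  -- STEP 6: the eigenfunction `φ = f₀ ∘ Γ`
  set φ : ℂ → ℂ := fun s ↦ f₀ (Γ s) with hφ
  have hφdiff : ∀ᶠ s in 𝓝 (0 : ℂ), DifferentiableAt ℂ φ s := by
    filter_upwards [hΓev] with s hs
    obtain ⟨hsrc, hΓd, -, -⟩ := hs
    have h := (hf₀d _ (hesrc hsrc).1).comp s hΓd
    exact mdifferentiableAt_iff_differentiableAt.mp h
  obtain ⟨U, hU, hUd⟩ := hφdiff.exists_mem
  have hφon : DifferentiableOn ℂ φ U := fun s hs ↦ (hUd s hs).differentiableWithinAt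
  have hbi : 1 ≤ (β i).val := hb i hi
  have heig : ∀ᶠ s in 𝓝 (0 : ℂ), φ (ζ * s) = ζ ^ ((β i).val - 1) * φ s := by
    filter_upwards [heq, hΓev] with s hs hs'
    have hΓs0 : Γ s ∈ liftDomain ψ 0 := (hesrc hs'.1).1
    have key := hf₀ a (Γ s) hΓs0
    rw [haprod, haχ, hs] at key
    -- `φ (ζ s) * ζ = ζ^b φ s`
    simp only [hφ]
    have hpow : ζ ^ (β i).val = ζ ^ ((β i).val - 1) * ζ := by
      rw [← pow_succ, Nat.sub_add_cancel hbi]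
    rw [hpow] at key
    apply mul_right_cancel₀ hζ0
    calc f₀ (Γ (ζ * s)) * ζ = ζ ^ ((β i).val - 1) * ζ * f₀ (Γ s) := key
      _ = ζ ^ ((β i).val - 1) * f₀ (Γ s) * ζ := by ring
  have hbig := isBigO_pow_of_rotation_eigen hU hφon hζ (c := (β i).val - 1)
    (by have := ZMod.val_lt (β i); omega) heig
  obtain ⟨C, hC⟩ := hbig.bound
  -- STEP 7: lower bounds for the other coordinates along `Γ`
  have hcoordcont : ∀ r, ContinuousAt (fun s ↦ projLift ψ 0 (Γ s) r) 0 := by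
    intro r
    have h1 : ContinuousAt (fun x ↦ projLift ψ 0 x r) p :=
      ((continuous_apply r).comp_continuousOn
        (mdifferentiableOn_projLift ψ hhol 0).continuousOn).continuousAt
        ((isOpen_liftDomain ψ hψc 0).mem_nhds hp)
    rw [← hΓ0] at h1
    exact h1.comp hΓcont
  have hlow : ∀ r, projLift ψ 0 p r ≠ 0 →
      ∀ᶠ s in 𝓝 (0 : ℂ), ‖projLift ψ 0 p r‖ / 2 ≤ ‖projLift ψ 0 (Γ s) r‖ := by
    intro r hr
    have ht : Tendsto (fun s ↦ ‖projLift ψ 0 (Γ s) r‖) (𝓝 0) (𝓝 ‖projLift ψ 0 p r‖) := by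
      have := (hcoordcont r).norm.tendsto
      rwa [hΓ0] at this
    have hlt : ‖projLift ψ 0 p r‖ / 2 < ‖projLift ψ 0 p r‖ := by
      have := norm_pos_iff.mpr hr; linarith
    exact (ht.eventually (lt_mem_nhds hlt)).mono fun s hs ↦ hs.le
  -- STEP 8: the bound along `Γ`
  set κ : ℝ := (‖c₀‖ / 2) ^ ((β j).val - 1) * (‖c₀'‖ / 2) ^ ((β l).val - 1) with hκ
  have hκpos : 0 < κ := by
    have h1 : 0 < ‖c₀‖ / 2 := by have := norm_pos_iff.mpr hc₀0; linarith
    have h2' : 0 < ‖c₀'‖ / 2 := by have := norm_pos_iff.mpr hc₀'0; linarith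
    positivity
  set C' : ℝ := max C 0 / κ with hC'
  have hΓbound : ∀ᶠ s in 𝓝 (0 : ℂ), s ≠ 0 → ‖Fq (Γ s)‖ ≤ C' := by
    filter_upwards [hC, hΓev, hlow j (by rw [hpj]; exact hc₀0), hlow l (by rw [hpl]; exact hc₀'0)]
      with s hCs hs hlj hll hs0
    obtain ⟨hsrc, -, hyi, hyj⟩ := hs
    have hΓs0 : Γ s ∈ liftDomain ψ 0 := (hesrc hsrc).1
    rw [hpj] at hlj
    rw [hpl] at hll
    rw [hFq, norm_div, norm_prod, hprod4]
    simp only [norm_pow, projLift_apply_self, norm_one, one_pow, one_mul, hyi]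
    -- denominator ≥ ‖s‖^(b_i - 1) * κ
    have hden : ‖s‖ ^ ((β i).val - 1) * κ ≤
        ‖s‖ ^ ((β i).val - 1) * ‖projLift ψ 0 (Γ s) j‖ ^ ((β j).val - 1) *
          ‖projLift ψ 0 (Γ s) l‖ ^ ((β l).val - 1) := by
      rw [hκ, ← mul_assoc]
      have h1 : (‖c₀‖ / 2) ^ ((β j).val - 1) ≤ ‖projLift ψ 0 (Γ s) j‖ ^ ((β j).val - 1) :=
        pow_le_pow_left₀ (by positivity) hlj _
      have h2' : (‖c₀'‖ / 2) ^ ((β l).val - 1) ≤ ‖projLift ψ 0 (Γ s) l‖ ^ ((β l).val - 1) :=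
        pow_le_pow_left₀ (by positivity) hll _
      have h0 : 0 ≤ ‖s‖ ^ ((β i).val - 1) := by positivity
      calc ‖s‖ ^ ((β i).val - 1) * (‖c₀‖ / 2) ^ ((β j).val - 1) * (‖c₀'‖ / 2) ^ ((β l).val - 1)
          ≤ ‖s‖ ^ ((β i).val - 1) * ‖projLift ψ 0 (Γ s) j‖ ^ ((β j).val - 1) *
              (‖c₀'‖ / 2) ^ ((β l).val - 1) := by gcongr
        _ ≤ _ := by gcongr
    have hspos : 0 < ‖s‖ ^ ((β i).val - 1) := pow_pos (norm_pos_iff.mpr hs0) _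
    have hdenpos : 0 < ‖s‖ ^ ((β i).val - 1) * κ := mul_pos hspos hκpos
    calc ‖φ s‖ / (‖s‖ ^ ((β i).val - 1) * ‖projLift ψ 0 (Γ s) j‖ ^ ((β j).val - 1) *
          ‖projLift ψ 0 (Γ s) l‖ ^ ((β l).val - 1))
        ≤ ‖φ s‖ / (‖s‖ ^ ((β i).val - 1) * κ) :=
          div_le_div_of_nonneg_left (norm_nonneg _) hdenpos hden
      _ ≤ (max C 0 * ‖s‖ ^ ((β i).val - 1)) / (‖s‖ ^ ((β i).val - 1) * κ) := by
          gcongr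
          calc ‖φ s‖ ≤ C * ‖s ^ ((β i).val - 1)‖ := hCs
            _ ≤ max C 0 * ‖s ^ ((β i).val - 1)‖ := by gcongr; exact le_max_left _ _
            _ = max C 0 * ‖s‖ ^ ((β i).val - 1) := by rw [norm_pow]
      _ = C' := by
          rw [hC']
          field_simp
  -- STEP 9: extract `δ` and transfer along the fibres
  obtain ⟨δ, hδpos, hδ⟩ := Metric.eventually_nhds_iff.mp (hΓbound.and hΓev)
  refine ⟨δ, hδpos, C', fun x hx hne hxi hline ↦ ?_⟩
  set s : ℂ := projLift ψ 0 x i with hsdef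
  have hs0 : s ≠ 0 := hne i
  have hsδ : dist s 0 < δ := by simpa using hxi
  obtain ⟨hbound, hsrc, -, hyi, hyj⟩ := hδ hsδ
  have hΓs0 : Γ s ∈ liftDomain ψ 0 := (hesrc hsrc).1
  -- same fibre: compare the `m`-th powers of all coordinates
  have hpow : ∀ r, projLift ψ 0 x r ^ m = projLift ψ 0 (Γ s) r ^ m := by
    have hr0 : projLift ψ 0 x 0 ^ m = projLift ψ 0 (Γ s) 0 ^ m := by
      rw [projLift_apply_self, projLift_apply_self]
    have hri : projLift ψ 0 x i ^ m = projLift ψ 0 (Γ s) i ^ m := by rw [hyi]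
    have hrj : projLift ψ 0 x j ^ m = projLift ψ 0 (Γ s) j ^ m := by
      rw [hyj, hcpow, hline]
    have hrl : projLift ψ 0 x l ^ m = projLift ψ 0 (Γ s) l ^ m := by
      have hx' := sum_projLift_pow_eq_zero hrange.le hx
      have hΓ' := sum_projLift_pow_eq_zero hrange.le hΓs0
      rw [hsum4] at hx' hΓ'
      rw [hr0, hri, hrj] at hx'
      linear_combination hx' - hΓ'
    intro r
    rcases hcover r with rfl | rfl | rfl | rfl
    exacts [hri, hrj, hr0, hrl]
  have hFeq := fermatQuotientFn_eq_of_pow_eq hΦψ hinj hb hsum hf₀ hFq hx hΓs0 hpow hne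
  -- `hFeq : Fq (Γ s) = Fq x`
  rw [← hFeq]
  exact hbound hs0

end Surface

end Literature.AlgebraicGeometry.HodgeTheory

end
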